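import Summits.CriticalPhenomena.PercolationContinuityZ3.Theorems.PercNearOneGluingNoHeavyLowerTailFrontierDecRowsPinnedEdgeInduction
import Summits.CriticalPhenomena.PercolationContinuityZ3.Theorems.PercNearOneGluingNoHeavyLowerTailFrontierIncRowsLeFive
import HarnessLib

/-!
# The pinned-terminal schema for INCREASING rows: group connections `U[X|Y]` with a singleton side

Support file (prover seat `prim-l12-p6`, gen 4; `--supports stmt-CriticalPhenomena-4575`).  No named facts, no sorries, no `native_decide`; one bookkeeping
definition `lnkPat` (the increasing twin of bnk-1's `sepPat`).  Sequel of `…FrontierDecRowsPinnedEdgeInduction`.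

`TerminalEdgeInduction.sahiE3_pev_nonneg_of_unmarkedEdgeHypAt` is row-agnostic: it needs one pattern event PINNED at the terminal `i₀` and the two other
events positively correlated under every `prodBernoulli`.  For three group CONNECTIONS `U[Xⱼ|Yⱼ]` (increasing; Harris for up-sets gives the correlation) one of
whose six sides is the single terminal `i₀`, the unmarked-edge hypotheses AT `i₀` ALONE (for every number of vertices) therefore give `0 ≤ E₃` at every
injective marking of every finite weighted graph: `sahiE3_lnk_nonneg_of_unmarkedEdgeHypAt`.  Instance: the increasing star (row 51 of
`…FrontierIncRowsLeFive`, `(U[a|b], U[a|c], U[a|y])`, in the tree only for `n ≤ 5`) for all `n` at pairwise distinct terminals from the five-point forms at ANY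
ONE terminal — `frontierInc_51_of_at (i₀ : Fin 4)`.  (The base case of the induction for an increasing pinned event `U[t|Y]` that is a.s. `Ω`:
`E₃(Ω,B,C) = μ(B∩C) − μ(B)μ(C) ≥ 0` by Harris for the two increasing events `B, C`.)
-/

noncomputable section

namespace Summit.CriticalPhenomena.PercolationContinuityZ3.Theorems

namespace TerminalEdgeInduction

open MeasureTheory Literature.Probability.Percolation Literature.Probability.LatticeModels
open EdgeInduction CovTransferCert E3GroupSepCert
open scoped Classical

variable {n k : ℕ}

/-- The group connection `U[X|Y]` of two sub-lists of the terminals as a pattern predicate (twin of `sepPat`). [this work] -/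
def lnkPat (I J : List (Fin k)) : (Fin k → Fin k → Bool) → Bool :=
  fun M => I.any fun i => J.any fun j => M i j

/-- `pev (lnkPat I J) x = connEvent (lnk (I.map x) (J.map x))`. [this work] -/
theorem pev_lnkPat (I J : List (Fin k)) (x : Fin k → Fin n) :
    pev (lnkPat I J) x = connEvent (lnk (I.map x) (J.map x)) := by
  unfold pev
  congr 1
  funext r
  simp only [lnkPat, lnk, List.any_map]
  rfl

/-- `U[{i₀}|J]` is pinned at `i₀`. [this work] -/
theorem pinnedPat_lnkPat_left (i₀ : Fin k) (J : List (Fin k)) : PinnedPat i₀ (lnkPat [i₀] J) := by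
  intro M M' hr _
  simp only [lnkPat, List.any_cons, List.any_nil, Bool.or_false]
  congr 1
  funext j
  rw [hr j]

/-- `U[I|{i₀}]` is pinned at `i₀`. [this work] -/
theorem pinnedPat_lnkPat_right (i₀ : Fin k) (I : List (Fin k)) : PinnedPat i₀ (lnkPat I [i₀]) := by
  intro M M' _ hc
  simp only [lnkPat, List.any_cons, List.any_nil, Bool.or_false]
  congr 1
  funext i
  rw [hc i]

/-- Harris for two group connections (both increasing). [folklore] -/
theorem real_mul_le_inter_lnk (w : Sym2 (Fin n) → unitInterval) (X Y X' Y' : List (Fin n)) :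
    (prodBernoulli w).real (connEvent (lnk X Y)) * (prodBernoulli w).real (connEvent (lnk X' Y')) ≤
      (prodBernoulli w).real (connEvent (lnk X Y) ∩ connEvent (lnk X' Y')) :=
  prodBernoulli_harris w (isUpperSet_connEvent_lnk X Y) (isUpperSet_connEvent_lnk X' Y') (Set.toFinite _).measurableSet
    (Set.toFinite _).measurableSet

/-- The pinned schema for three group connections with the FIRST one pinned at `i₀` (`I₁ = [i₀]` or `J₁ = [i₀]`). [this work] -/
theorem sahiE3_lnk_nonneg_of_unmarkedEdgeHypAt_first (i₀ : Fin k) (I₁ J₁ I₂ J₂ I₃ J₃ : List (Fin k)) (hpin : I₁ = [i₀] ∨ J₁ = [i₀])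
    (h : ∀ m : ℕ, UnmarkedEdgeHypAt i₀ (fun x : Fin k → Fin m => connEvent (lnk (I₁.map x) (J₁.map x)))
      (fun x => connEvent (lnk (I₂.map x) (J₂.map x))) (fun x => connEvent (lnk (I₃.map x) (J₃.map x))))
    (w : Sym2 (Fin n) → unitInterval) (x : Fin k → Fin n) (hx : Function.Injective x) :
    0 ≤ sahiE3 (prodBernoulli w) (connEvent (lnk (I₁.map x) (J₁.map x))) (connEvent (lnk (I₂.map x) (J₂.map x)))
      (connEvent (lnk (I₃.map x) (J₃.map x))) := by
  have e : ∀ (m : ℕ) (I J : List (Fin k)), (fun x : Fin k → Fin m => connEvent (lnk (I.map x) (J.map x))) = fun x => pev (lnkPat I J) x :=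
    fun m I J => funext fun x => (pev_lnkPat I J x).symm
  have hΦ : PinnedPat i₀ (lnkPat I₁ J₁) := by
    rcases hpin with rfl | rfl
    · exact pinnedPat_lnkPat_left i₀ J₁
    · exact pinnedPat_lnkPat_right i₀ I₁
  rw [← pev_lnkPat, ← pev_lnkPat, ← pev_lnkPat]
  refine sahiE3_pev_nonneg_of_unmarkedEdgeHypAt i₀ _ _ _ hΦ (fun m w' x' => ?_) (fun m => ?_) w x hx
  · rw [pev_lnkPat, pev_lnkPat]; exact real_mul_le_inter_lnk w' _ _ _ _
  · rw [← e m I₁ J₁, ← e m I₂ J₂, ← e m I₃ J₃]; exact h m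

/-- **Group-connection (increasing) rows, pinned at one terminal.**  For three group connections `U[X₁|Y₁], U[X₂|Y₂], U[X₃|Y₃]` of sub-lists of `k`
terminals such that the terminal `i₀` ALONE is one of the six sides, the unmarked-edge hypotheses at `i₀` (for all numbers of vertices) give `0 ≤ E₃` at
every injective marking of every finite weighted graph. [this work] -/
theorem sahiE3_lnk_nonneg_of_unmarkedEdgeHypAt (i₀ : Fin k) (I₁ J₁ I₂ J₂ I₃ J₃ : List (Fin k))
    (hpin : I₁ = [i₀] ∨ J₁ = [i₀] ∨ I₂ = [i₀] ∨ J₂ = [i₀] ∨ I₃ = [i₀] ∨ J₃ = [i₀])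
    (h : ∀ m : ℕ, UnmarkedEdgeHypAt i₀ (fun x : Fin k → Fin m => connEvent (lnk (I₁.map x) (J₁.map x)))
      (fun x => connEvent (lnk (I₂.map x) (J₂.map x))) (fun x => connEvent (lnk (I₃.map x) (J₃.map x))))
    (w : Sym2 (Fin n) → unitInterval) (x : Fin k → Fin n) (hx : Function.Injective x) :
    0 ≤ sahiE3 (prodBernoulli w) (connEvent (lnk (I₁.map x) (J₁.map x))) (connEvent (lnk (I₂.map x) (J₂.map x)))
      (connEvent (lnk (I₃.map x) (J₃.map x))) := by
  rcases hpin with h1 | h1 | h2 | h2 | h3 | h3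
  · exact sahiE3_lnk_nonneg_of_unmarkedEdgeHypAt_first i₀ I₁ J₁ I₂ J₂ I₃ J₃ (Or.inl h1) h w x hx
  · exact sahiE3_lnk_nonneg_of_unmarkedEdgeHypAt_first i₀ I₁ J₁ I₂ J₂ I₃ J₃ (Or.inr h1) h w x hx
  · rw [sahiE3_comm₁₂]
    exact sahiE3_lnk_nonneg_of_unmarkedEdgeHypAt_first i₀ I₂ J₂ I₁ J₁ I₃ J₃ (Or.inl h2) (fun m => (h m).swap₁₂) w x hx
  · rw [sahiE3_comm₁₂]
    exact sahiE3_lnk_nonneg_of_unmarkedEdgeHypAt_first i₀ I₂ J₂ I₁ J₁ I₃ J₃ (Or.inr h2) (fun m => (h m).swap₁₂) w x hx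
  · rw [sahiE3_comm₂₃, sahiE3_comm₁₂]
    exact sahiE3_lnk_nonneg_of_unmarkedEdgeHypAt_first i₀ I₃ J₃ I₁ J₁ I₂ J₂ (Or.inl h3) (fun m => (h m).swap₂₃.swap₁₂) w x hx
  · rw [sahiE3_comm₂₃, sahiE3_comm₁₂]
    exact sahiE3_lnk_nonneg_of_unmarkedEdgeHypAt_first i₀ I₃ J₃ I₁ J₁ I₂ J₂ (Or.inr h3) (fun m => (h m).swap₂₃.swap₁₂) w x hx

/-- **The increasing star `(U[a|b], U[a|c], U[a|y])` (row 51 of `…FrontierIncRowsLeFive`) at pairwise distinct terminals, for ALL `n`, from the five-point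
forms at ANY ONE terminal** (hub `a` or a leaf): every terminal is a singleton side. [this work] -/
theorem frontierInc_51_of_at (i₀ : Fin 4)
    (h : ∀ m : ℕ, UnmarkedEdgeHypAt i₀ (fun x : Fin 4 → Fin m => connEvent (FrontierIncRows.row 51 m (x 0, x 1, x 2, x 3)).1)
      (fun x => connEvent (FrontierIncRows.row 51 m (x 0, x 1, x 2, x 3)).2.1)
      (fun x => connEvent (FrontierIncRows.row 51 m (x 0, x 1, x 2, x 3)).2.2))
    (w : Sym2 (Fin n) → unitInterval) (a b c y : Fin n) (hab : a ≠ b) (hac : a ≠ c) (hay : a ≠ y) (hbc : b ≠ c)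
    (hby : b ≠ y) (hcy : c ≠ y) :
    0 ≤ sahiE3 (prodBernoulli w) (connEvent (FrontierIncRows.row 51 n (a, b, c, y)).1)
      (connEvent (FrontierIncRows.row 51 n (a, b, c, y)).2.1) (connEvent (FrontierIncRows.row 51 n (a, b, c, y)).2.2) := by
  have hx := injective_vec4 hab hac hay hbc hby hcy
  have hpin : [0] = [i₀] ∨ [1] = [i₀] ∨ [0] = [i₀] ∨ [2] = [i₀] ∨ [0] = [i₀] ∨ [3] = [i₀] := by
    fin_cases i₀ <;> decide
  exact sahiE3_lnk_nonneg_of_unmarkedEdgeHypAt i₀ [0] [1] [0] [2] [0] [3] hpin h w ![a, b, c, y] hx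

end TerminalEdgeInduction

end Summit.CriticalPhenomena.PercolationContinuityZ3.Theorems
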